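import Summits.NavierStokesRegularity.NavierStokesRegularity.Theorems.ScenarioCensusRowF1IntQuenchTransfer
import Summits.NavierStokesRegularity.NavierStokesRegularity.Theorems.ScenarioCensusRowF1IntStretchBudget
import HarnessLib

/-!
# LINE «integrated-quench» port, part 7/7: §7 the integrated rows — `Row_F1iq` / `rowF1iq_holds`, floor `DivergentIntensification` / `divergentIntensification_holds`, residual
# `IqSlack` (≡ `Row_F1`), dictionary, displays; census KEYS `Row_F1iq` + `_excluded`, floor

Re-homed for the scenario census (typer seat ns-census-typer-1 g8; the cell F1iq and the floor DI are MEMBERS OF RECORD «DECIDED IN KERNEL IN FILES» of row F1 since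
census v1.76 (critic idea-crit-3 g7 PASS — no price 01:59:11Z; ref ns-census-ref g9 PRE-CHECK ✓ §14.27 item 35; lead-presearch label); this port makes them TREE-decided):
VERBATIM PORT of ns-idea-3 LINE 22 «integrated-quench», `pub/ideators/ns-idea-3/lines/integrated-quench/line-integrated-quench.lean` sha16 d7402efa28ebc137 (2066 l.,
lean check rc 0, 0 sorry), split for the 400-line rule into seven parts `ScenarioCensusRowF1IntQuench{∅, Kill, Cutoff, Enstrophy, Liouville, Transfer, Top}` (chain
imports).  Lean text VERBATIM in namespace `…Theorems.ScenarioCensus.IntegratedQuench` (the line's `…Cruxes.ScenarioCensusRowF1.IntegratedQuenchLine` re-homed); port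
edits: the bracket lines `section IntegralTransfer` / `end IntegralTransfer` dropped (no `variable`s), `@[conjecture]` on the residual `IqSlack` (≡ `ScenarioCensus.Row_F1`,
OPEN), forty-five one-line docstrings added (gate lint); lemmas the line shares VERBATIM with the landed inviscid-top / frozen-top / columnar-top / stretched-top /
integrated-stretch ports are taken BY NAME (listed below); `norm_laplacian_curl_le` (twin of the tree's `clockAP_norm_laplacian_curl_le`, whose module has no farm build) is
not re-declared and its single use carries the line's own proof as a local `have` (proof text only).  Statements untouched.

No census VALUE is moved here (row F1 stays OPEN-WITH-LINE; the members become TREE-decided by name); NS regularity is NOT proved; `Row_F1` is untouched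
(zero movement, `iqSlack_iff_rowF1`); no summit statement is proved by this file. Lemmas that restate already-landed tree declarations are taken BY NAME (gate lint `dedup.landed`): `convect_curl_self` = `FrozenTop.convect_curl_self`, `fderiv_smul_stPull_apply` = `InviscidTop.fderiv_smul_stPull_apply`, `fderiv_smul_stPull` = `InviscidTop.fderiv_smul_stPull`, `fderiv_fderiv_smul_stPull` = `InviscidTop.fderiv_fderiv_smul_stPull`, `tendsto_clm_of_tendsto_apply` = `InviscidTop.tendsto_clm_of_tendsto_apply`, `tendsto_fderiv_fderiv_apply_of_bound` = `InviscidTop.tendsto_fderiv_fderiv_apply_of_bound`, `tendsto_fderiv_fderiv_of_bound` = `InviscidTop.tendsto_fderiv_fderiv_of_bound`, `tendsto_fderiv_fderiv_of_typeI_seq_Ioo` = `InviscidTop.tendsto_fderiv_fderiv_of_typeI_seq_Ioo`, `fderiv3_smul_stPull` = `FrozenTop.fderiv3_smul_stPull`, `tendsto_fderiv3_of_typeI_seq_Ioo` = `FrozenTop.tendsto_fderiv3_of_typeI_seq_Ioo`, `tendsto_physicalTime` = `ColumnarTop.tendsto_physicalTime`, `eventually_fast` = `ColumnarTop.eventually_fast`,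 `sqrt_timeLag` = `StretchedTop.sqrt_timeLag`, `forall_of_forall_ne_zero` = `StretchedTop.forall_of_forall_ne_zero`, `radius_eq` = `FrozenTop.radius_eq`, `jointCond_everywhere₆` = `FrozenTop.jointCond_everywhere₄`, `continuousOn_quad` = `IntegratedStretch.continuousOn_quad`, `sqrt_nu_timeLag` = `IntegratedStretch.sqrt_nu_timeLag`, `continuous_maxRdnu` = `IntegratedStretch.continuous_maxRdnu`, `sing_of_not_bounded` = `InviscidTop.sing_of_not_bounded`, `nonIntensifying_ancient_trivial` = `eq_zero_of_nonIntensifying`, `vort_eq` = `FrozenTop.freeze_eq`, `exists_singularZoom_package₃` = `FrozenTop.exists_singularZoom_package₃`, `lapD_eq_zero_of_eq_zero` = `FrozenTop.lapD_eq_zero_of_eq_zero`, `measurableSet_top` = `IntegratedStretch.measurableSet_top`.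
-/

-- the summit and its single problem share the name `NavierStokesRegularity` (D-0017 nested layout)
set_option linter.dupNamespace false

noncomputable section

open MeasureTheory Set Function Filter TopologicalSpace Metric
open scoped Topology NNReal ENNReal InnerProductSpace RealInnerProductSpace Laplacian

namespace Summit.NavierStokesRegularity.NavierStokesRegularity.Theorems.ScenarioCensus.IntegratedQuench

open Literature.Analysis Literature.Analysis.FluidPDE
open Summit.NavierStokesRegularity.NavierStokesRegularity.Theorems

/-! ## §7 The INTEGRATED rows: the number, the row `F1iq`, the floor DIVERGENT INTENSIFICATION, the residual;
the row is EXCLUDED (`rowF1iq_holds`); dictionary to the kinematic number; residual ≡ `Row_F1` -/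

/-- The number of the line — the **INTENSIFICATION INTEGRAND OF THE FAST FLUID** (dynamic form, no pressure, no
viscosity): `𝟙{t ∈ [0,T), Λ(t) < |u(t,x)|} · √(T − t) · max(0, ⟪ω, ∂ₜω + (u·∇)ω⟫(t, x))`, `ω = curl u`
(`⟪ω, ∂ₜω + (u·∇)ω⟫ = ½ Dₜ|ω|²`: HALF THE MATERIAL RATE of the enstrophy density; ONE-SIDED — decay of `|ω|` along
particle paths is free, only intensification is charged; `∂ₜ` within `[0, T)`, `vorticity u t = curl (u t)`). -/
def intensificationIntegrand (T : ℝ) (Λ : ℝ → ℝ) (u : ℝ → E3 → E3) : ℝ × E3 → ℝ≥0∞ :=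
  {z : ℝ × E3 | z.1 ∈ Ico 0 T ∧ Λ z.1 < ‖u z.1 z.2‖}.indicator fun z =>
    ENNReal.ofReal (Real.sqrt (T - z.1) *
      max 0 ⟪curl (u z.1) z.2,
        timeDerivWithin (Ico 0 T) (vorticity u) z.1 z.2 + convect (u z.1) (curl (u z.1)) z.2⟫)

/-- Kinematic form of the number (through the vorticity equation): `√(T − t) · max(0, ⟪ω, ν Δω + (ω·∇)u⟫)` on the top —
vortex STRETCHING net of diffusive quenching, positive part. -/
def stretchIntegrand (T ν : ℝ) (Λ : ℝ → ℝ) (u : ℝ → E3 → E3) : ℝ × E3 → ℝ≥0∞ :=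
  {z : ℝ × E3 | z.1 ∈ Ico 0 T ∧ Λ z.1 < ‖u z.1 z.2‖}.indicator fun z =>
    ENNReal.ofReal (Real.sqrt (T - z.1) *
      max 0 ⟪curl (u z.1) z.2, ν • (Δ (curl (u z.1))) z.2 + convect (curl (u z.1)) (u z.1) z.2⟫)

/-- **INTEGRABLY QUENCHED TOP** at the level `Λ`: the space–time (lower Lebesgue) integral over `[0, T) × ℝ³` of the
intensification integrand of the `Λ`-fast fluid is FINITE: `∬_{|u| > Λ(t)} √(T − t) [½ Dₜ|ω|²]₊ dx dt < ∞`.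
PARAMETER-FREE (no `ε`, no `M`): the first hypothesis of the one-sided family that is a plain integrability class. -/
def HasIntegrablyQuenchedTop (T : ℝ) (Λ : ℝ → ℝ) (u : ℝ → E3 → E3) : Prop :=
  ∫⁻ z, intensificationIntegrand T Λ u z < ⊤

/-- **Criterion row F1iq** (the exact frame of `Row_F1` plus ONE hypothesis: an integrably quenched top at some
MEASURABLE subcritical level).  PROVED (`rowF1iq_holds`).  The weight `√(T − t)` is the scale-invariant one
(`[½Dₜ|ω|²] ~ (T−t)⁻³`, parabolic boxes `~ (T−t)^{5/2}`): exactly the weight for which the zoom charts pull the number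
back WITHOUT a factor of `c_j`. -/
def Row_F1iq : Prop :=
  ∀ (ν T : ℝ), 0 < ν → 0 < T → ∀ (u : ℝ → E3 → E3) (p : ℝ → E3 → ℝ),
    IsClassicalNSSolutionOn (Ico 0 T) ν 0 u p → IsLerayHopfOn T ν 0 (u 0) u →
    HasRapidSpatialDecay (u 0) → IsTypeIBlowup u T →
    (∃ Λ : ℝ → ℝ, IsSubcriticalLevel T Λ ∧ Measurable Λ ∧ HasIntegrablyQuenchedTop T Λ u) →
    HasSmoothExtensionPast ν 0 u T

/-- **DIVERGENT INTENSIFICATION** (structural floor, maximal frame): a maximal Type-I Clay blow-up has, at EVERY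
measurable subcritical level, an INFINITE integrated intensification of its fast fluid:
`∬_{|u| > Λ(t)} √(T − t) [½ Dₜ|ω|²]₊ dx dt = ∞`.  PROVED (`divergentIntensification_holds`). -/
def DivergentIntensification : Prop :=
  ∀ (ν T : ℝ), 0 < ν → 0 < T → ∀ (u : ℝ → E3 → E3) (p : ℝ → E3 → ℝ),
    IsMaximalSmoothSolution ν 0 u p T → IsLerayHopfOn T ν 0 (u 0) u →
    HasRapidSpatialDecay (u 0) → IsTypeIBlowup u T →
    ∀ Λ : ℝ → ℝ, IsSubcriticalLevel T Λ → Measurable Λ → ∫⁻ z, intensificationIntegrand T Λ u z = ⊤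

/-- **Residual** (maximal frame): every maximal Type-I Clay blow-up has an integrably quenched top at some measurable
subcritical level.  DECLARED ≡ row F1 (`iqSlack_iff_rowF1`); no movement on `Row_F1` is claimed. -/
@[conjecture] def IqSlack : Prop :=
  ∀ (ν T : ℝ), 0 < ν → 0 < T → ∀ (u : ℝ → E3 → E3) (p : ℝ → E3 → ℝ),
    IsMaximalSmoothSolution ν 0 u p T → IsLerayHopfOn T ν 0 (u 0) u →
    HasRapidSpatialDecay (u 0) → IsTypeIBlowup u T →
    ∃ Λ : ℝ → ℝ, IsSubcriticalLevel T Λ ∧ Measurable Λ ∧ HasIntegrablyQuenchedTop T Λ u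

/-- **The split**: criterion + residual ⇒ row F1 (by cases on extendability). -/
theorem rowF1_of (hD : Row_F1iq) (hR : IqSlack) : ScenarioCensus.Row_F1 := by
  unfold ScenarioCensus.Row_F1
  intro ν T hν hT u p hsol hLH hdec hTI
  by_contra hext
  exact hext (hD ν T hν hT u p hsol hLH hdec hTI (hR ν T hν hT u p ⟨hsol, hext⟩ hLH hdec hTI))

/-- The residual is a consequence of the row (vacuously: under `Row_F1` no maximal solution is Type I). -/
theorem iqSlack_of_rowF1 (h : ScenarioCensus.Row_F1) : IqSlack :=
  fun ν T hν hT u p hmax hLH hdec hTI => (hmax.2 (h ν T hν hT u p hmax.1 hLH hdec hTI)).elim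

-- `sing_of_not_bounded`: the line restates the tree's `InviscidTop.sing_of_not_bounded`; taken BY NAME (gate lint dedup.landed).

/-! ### Dictionary: the number = `ν^{5/2} ×` the normalised top integrand of the weight-6 read-out `intensOf` -/

/-- The kinematic and the dynamic integrands agree for classical solutions on `[0, T)` (vorticity equation). -/
theorem stretchIntegrand_eq {ν T : ℝ} (hT : 0 < T) {u : ℝ → E3 → E3} {p : ℝ → E3 → ℝ}
    (hsol : IsClassicalNSSolutionOn (Ico 0 T) ν 0 u p) (Λ : ℝ → ℝ) :
    stretchIntegrand T ν Λ u = intensificationIntegrand T Λ u := by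
  funext z
  by_cases hz : z ∈ {z : ℝ × E3 | z.1 ∈ Ico 0 T ∧ Λ z.1 < ‖u z.1 z.2‖}
  · rw [stretchIntegrand, intensificationIntegrand, indicator_of_mem hz, indicator_of_mem hz,
      quench_eq hT hsol hz.1 z.2]
  · rw [stretchIntegrand, intensificationIntegrand, indicator_of_notMem hz, indicator_of_notMem hz]

/-- Pointwise: `topIntegrand(intensOf) = ν^{-5/2} · intensificationIntegrand` (`ν³ intensOf(u/ν, …) = ⟪ω, νΔω + (ω·∇)u⟫ =
⟪ω, ∂ₜω + (u·∇)ω⟫`, `√(ν(T−t)) = √ν √(T−t)`). -/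
theorem topIntegrand_intensOf_eq {ν T : ℝ} (hν : 0 < ν) (hT : 0 < T) {u : ℝ → E3 → E3} {p : ℝ → E3 → ℝ}
    (hsol : IsClassicalNSSolutionOn (Ico 0 T) ν 0 u p) (Λ : ℝ → ℝ) (z : ℝ × E3) :
    topIntegrand T ν Λ (fun v L H K => intensOf v L H K) u z =
      ENNReal.ofReal (Real.sqrt ν * (ν ^ 3)⁻¹) * intensificationIntegrand T Λ u z := by
  by_cases hz : z ∈ {z : ℝ × E3 | z.1 ∈ Ico 0 T ∧ Λ z.1 < ‖u z.1 z.2‖}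
  · rw [topIntegrand, intensificationIntegrand, indicator_of_mem hz, indicator_of_mem hz,
      ← ENNReal.ofReal_mul (mul_nonneg (Real.sqrt_nonneg ν) (inv_nonneg.2 (pow_nonneg hν.le 3)))]
    congr 1
    have h3 : ContDiff ℝ 3 (u z.1) := (hsol.contDiff_velocity hz.1).of_le (by norm_cast)
    have key := nu_readout_intensOf hν 1 h3 z.2
    rw [← quench_eq hT hsol hz.1 z.2, mul_one, one_mul] at key
    have hν3 : ν ^ 3 ≠ 0 := by positivity
    have hI : intensOf (ν⁻¹ • u z.1 z.2) (ν⁻¹ • fderiv ℝ (u z.1) z.2) (ν⁻¹ • fderiv ℝ (fderiv ℝ (u z.1)) z.2)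
        (ν⁻¹ • lapD (u z.1) z.2) = (ν ^ 3)⁻¹ *
        ⟪curl (u z.1) z.2, timeDerivWithin (Ico 0 T) (vorticity u) z.1 z.2 + convect (u z.1) (curl (u z.1)) z.2⟫ := by
      rw [eq_inv_mul_iff_mul_eq₀ hν3]
      exact key
    have hmax : ∀ P : ℝ, max 0 ((ν ^ 3)⁻¹ * P) = (ν ^ 3)⁻¹ * max 0 P := fun P => by
      rw [mul_max_of_nonneg _ _ (inv_nonneg.2 (pow_nonneg hν.le 3)), mul_zero]
    rw [hI, Real.sqrt_mul hν.le, hmax]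
    ring
  · rw [topIntegrand, intensificationIntegrand, indicator_of_notMem hz, indicator_of_notMem hz, mul_zero]

/-- `∫ topIntegrand(intensOf) = ν^{-5/2} ∫ intensificationIntegrand`. -/
theorem lintegral_topIntegrand_intensOf_eq {ν T : ℝ} (hν : 0 < ν) (hT : 0 < T) {u : ℝ → E3 → E3}
    {p : ℝ → E3 → ℝ} (hsol : IsClassicalNSSolutionOn (Ico 0 T) ν 0 u p) (Λ : ℝ → ℝ) :
    ∫⁻ z, topIntegrand T ν Λ (fun v L H K => intensOf v L H K) u z =
      ENNReal.ofReal (Real.sqrt ν * (ν ^ 3)⁻¹) * ∫⁻ z, intensificationIntegrand T Λ u z := by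
  rw [← lintegral_const_mul' _ _ ENNReal.ofReal_ne_top]
  exact lintegral_congr fun z => topIntegrand_intensOf_eq hν hT hsol Λ z

/-! ### The row is EXCLUDED; the floor; the residual ≡ `Row_F1` -/

/-- **Criterion row F1iq is EXCLUDED** (in kernel): Type I + an integrably quenched top (measurable subcritical level)
⇒ smooth extension.  Engine: singular zoom at a non-extendable point (`FrozenTop.exists_singularZoom_package₃`) → the INTEGRAL
TRANSFER `integral_transfer₆` (scale-invariant pull-back + shrinking supports + Fatou) gives `intensOf(W, ∇W, ∇²W, K) ≤ 0`
wherever `W ≠ 0` → analytic globalisation (`FrozenTop.jointCond_everywhere₄`) → the line's Liouville theorem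
`eq_zero_of_nonIntensifying` (L21) → `W ≡ 0`, contradicting non-triviality of the zoom limit. -/
theorem rowF1iq_holds : Row_F1iq := by
  intro ν T hν hT u p hsol hLH hdec hTI htop
  obtain ⟨Λ, hΛ, hΛm, hfinP⟩ := htop
  obtain ⟨M, hM⟩ := exists_isTypeIBlowupWith hν hTI
  have hfin : ∫⁻ z, topIntegrand T ν Λ (fun v L H K => intensOf v L H K) u z < ⊤ := by
    rw [lintegral_topIntegrand_intensOf_eq hν hT hsol Λ]
    exact ENNReal.mul_lt_top ENNReal.ofReal_lt_top hfinP
  apply hasSmoothExtensionPast_of_forall_exists_parabolicCylinder hν hT hsol hLH hdec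
  intro x₀
  by_contra hno
  obtain ⟨α, β, R, c, W, hα, hβ, hR, hαR, hαν, hcpos, hclim, hW, hpt, hgrad, hhess, hlap, t, ht, y, hne⟩ :=
    FrozenTop.exists_singularZoom_package₃ hν hT hsol hLH hdec hM x₀ (InviscidTop.sing_of_not_bounded hno)
  have hRd := integral_transfer₆ hν hT hsol hW hα hβ hαR hαν hcpos hclim hpt hgrad hhess hlap
    (Rd := fun v L H K => intensOf v L H K) continuous_intensOf (fun a _ v L H K => intensOf_smul v L H K)
    hΛ hΛm hfin
  have hall := FrozenTop.jointCond_everywhere₄ hW (P := fun _ q => intensOf q.1 q.2.1 q.2.2.1 q.2.2.2 ≤ 0)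
    (fun _ => isClosed_le continuous_intensOf continuous_const)
    (fun _ => by show intensOf 0 0 0 0 ≤ 0; rw [intensOf_zero]) hRd
  refine hne (eq_zero_of_nonIntensifying hW (fun s hs y' => ?_) t ht y)
  have h3 : ContDiff ℝ 3 (W s) := (hW.contDiff_slice hs).of_le (by norm_cast)
  rw [intens_eq h3]
  exact hall s hs y'

/-- **ε-FREE LAGRANGIAN SIGN DISPLAY** (the integrated row contains the sign row): Type I + at some measurable
subcritical level the vorticity magnitude of the fast fluid NEVER intensifies along particle paths
(`⟪ω, ∂ₜω + (u·∇)ω⟫ = ½Dₜ|ω|² ≤ 0` at every `Λ`-fast point of `[0, T) × ℝ³`) ⇒ smooth extension — the number of the line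
vanishes identically.  No `ε`, no `M`. -/
theorem rowF1_signTop : ∀ (ν T : ℝ), 0 < ν → 0 < T → ∀ (u : ℝ → E3 → E3) (p : ℝ → E3 → ℝ),
    IsClassicalNSSolutionOn (Ico 0 T) ν 0 u p → IsLerayHopfOn T ν 0 (u 0) u →
    HasRapidSpatialDecay (u 0) → IsTypeIBlowup u T →
    (∃ Λ : ℝ → ℝ, IsSubcriticalLevel T Λ ∧ Measurable Λ ∧
      ∀ t ∈ Ico 0 T, ∀ x, Λ t < ‖u t x‖ →
        ⟪curl (u t) x, timeDerivWithin (Ico 0 T) (vorticity u) t x + convect (u t) (curl (u t)) x⟫ ≤ 0) →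
    HasSmoothExtensionPast ν 0 u T := by
  intro ν T hν hT u p hsol hLH hdec hTI htop
  obtain ⟨Λ, hΛ, hΛm, hsign⟩ := htop
  refine rowF1iq_holds ν T hν hT u p hsol hLH hdec hTI ⟨Λ, hΛ, hΛm, ?_⟩
  have h0 : intensificationIntegrand T Λ u = fun _ => 0 := by
    funext z
    unfold intensificationIntegrand
    by_cases hz : z ∈ {z : ℝ × E3 | z.1 ∈ Ico 0 T ∧ Λ z.1 < ‖u z.1 z.2‖}
    · rw [indicator_of_mem hz, max_eq_left (hsign z.1 hz.1 z.2 hz.2), mul_zero, ENNReal.ofReal_zero]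
    · rw [indicator_of_notMem hz]
  have hI : ∫⁻ z, intensificationIntegrand T Λ u z = 0 := by simp [h0]
  show ∫⁻ z, intensificationIntegrand T Λ u z < ⊤
  rw [hI]
  exact ENNReal.zero_lt_top

/-- **The floor DIVERGENT INTENSIFICATION holds.** -/
theorem divergentIntensification_holds : DivergentIntensification := by
  intro ν T hν hT u p hmax hLH hdec hTI Λ hΛ hΛm
  by_contra hne
  exact hmax.2 (rowF1iq_holds ν T hν hT u p hmax.1 hLH hdec hTI ⟨Λ, hΛ, hΛm, lt_top_iff_ne_top.2 hne⟩)

/-- **DIVERGENT INTENSIFICATION, constant levels, kinematic display**: for a maximal Type-I Clay blow-up and EVERY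
speed `Λ`, `∬_{[0,T)×ℝ³, |u| > Λ} √(T − t) · max(0, ⟪ω, ν Δω + (ω·∇)u⟫) dx dt = ∞` — the positive part of vortex
stretching net of diffusion of the `Λ`-fast fluid is NOT integrable against the scale-invariant weight. -/
theorem divergentIntensification_const_stretch : ∀ (ν T : ℝ), 0 < ν → 0 < T →
    ∀ (u : ℝ → E3 → E3) (p : ℝ → E3 → ℝ),
    IsMaximalSmoothSolution ν 0 u p T → IsLerayHopfOn T ν 0 (u 0) u →
    HasRapidSpatialDecay (u 0) → IsTypeIBlowup u T →
    ∀ Λ : ℝ, ∫⁻ z, stretchIntegrand T ν (fun _ => Λ) u z = ⊤ := by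
  intro ν T hν hT u p hmax hLH hdec hTI Λ
  rw [stretchIntegrand_eq hT hmax.1]
  exact divergentIntensification_holds ν T hν hT u p hmax hLH hdec hTI (fun _ => Λ) (isSubcriticalLevel_const T Λ)
    measurable_const

-- `nonIntensifying_ancient_trivial`: the line restates the tree's `eq_zero_of_nonIntensifying`; taken BY NAME (gate lint dedup.landed).

/-- The residual is EXACTLY row F1 (declared; no movement on `Row_F1` is claimed). -/
theorem iqSlack_iff_rowF1 : IqSlack ↔ ScenarioCensus.Row_F1 :=
  ⟨rowF1_of rowF1iq_holds, iqSlack_of_rowF1⟩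

/-- Deciding direction used by the split. -/
theorem rowF1_of_iqSlack : IqSlack → ScenarioCensus.Row_F1 :=
  rowF1_of rowF1iq_holds

end Summit.NavierStokesRegularity.NavierStokesRegularity.Theorems.ScenarioCensus.IntegratedQuench

namespace Summit.NavierStokesRegularity.NavierStokesRegularity.Theorems.ScenarioCensus

/-! ## Census KEYS (ns `…Theorems.ScenarioCensus`): the INTEGRATED-QUENCH member of row F1 — TREE-decided F1iq and floor -/

/-- **Cell F1iq** (row F1 frame VERBATIM + an integrably quenched top `∬_{|u|>Λ} √(T−t)[½Dₜ|ω|²]₊ < ∞` at some measurable subcritical level ⇒ smooth extension past `T`): `:= IntegratedQuench.Row_F1iq`. DECIDED. -/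
def Row_F1iq : Prop := IntegratedQuench.Row_F1iq
/-- F1iq is EXCLUDED (decided in the tree): `IntegratedQuench.rowF1iq_holds`. -/
theorem row_F1iq_excluded : Row_F1iq := IntegratedQuench.rowF1iq_holds

/-- **Floor DIVERGENT INTENSIFICATION** at the level of the census keys: `IntegratedQuench.divergentIntensification_holds`. -/
theorem row_F1_divergentIntensification : IntegratedQuench.DivergentIntensification := IntegratedQuench.divergentIntensification_holds

end Summit.NavierStokesRegularity.NavierStokesRegularity.Theorems.ScenarioCensus

end
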